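import Summits.BirchSwinnertonDyer.BirchSwinnertonDyer.Theorems.GenusKolyvaginAtTwoShaCardDvdPowAtTwoPosTB2QSignFree
import Summits.BirchSwinnertonDyer.BirchSwinnertonDyer.Theorems.GenusKolyvaginAtTwoEquivariantKolyvaginExactAtTwoPropFourFourRat
import HarnessLib

/-!
# Route `GenusKolyvaginAtTwo`, crux U₂ `MinimalTwinBSDTwo` (stmt-BirchSwinnertonDyer-22985), LINE 23 «twin_swap» v2.5, stub DIV′ —
# THE SWAPPED KOLYVAGIN ENGINE, SIGN-FREE (B2Q⁻±): Kolyvagin's Theorem B₂ at `l = 2` over `ℚ` FOR THE TWIN `E^{(d_K)}` of a root-number `−1`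
# Heegner member, SHARP, for EITHER SIGN of `Δ(W)`: `2^{M₀} · Sel_(2^M)(E^{(d_K)}/ℚ) = 0`, modulo Q2 only

Seat `bsd-line-gk2-p2` g31 (PROVER seat 2/3, cell `bsd-f1-sign2`, LINE 23 holder), `--supports stmt-BirchSwinnertonDyer-22985 --as helper`.
THEOREMS ONLY (no definition, no named fact, no `sorry`).  BSD is NOT proved by any of this; neither is U₂, nor DIV′, nor NDIV′.

WHAT.  This seat's `…MinimalTwinBSDTwoTwinShaAnnihilation` (B2Q⁻, p808930) with its hypothesis `Δ(W) < 0` DELETED — exactly as gk2-p5 g31's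
`…PosTB2QSignFree.stub_b2qSignFree` deletes it from LINE 19's B2Q.  The four uses of `Δ < 0` in B2Q⁻ are replaced by their regular / margin-one
twins, all already in the tree:
(1) the Čebotarev step is the REGULAR SIGNED PAIR-ČEBOTAREV SUPPLY `regularPairSupply_of_heegner` (gk2-p4 g23 p754753 / gk2-p5 g31, any sign of `Δ`),
    read with signs `(−1, +1)` for the pair `(hPsiKT (res s₀), c_{M+1}(1))`;
(2) the archimedean Selmer condition of the TWIN ℚ-descent of the anti-invariant class `c_M(ℓ)` is FREE at margin one — gk2-p5 g31
    `SelmerDescent.mem_selmerLocalKer_infinitePlace_twin_of_hPsiKT_resTorsion_eq_kolyvaginClass_two_of_margin` (`…PosTArchimedeanMarginOne` §3, sign `−`);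
(3) McCallum 5.3 + 2.2 over `ℚ_ℓ` for the twin equation at a REGULAR prime — sibling crux 23716's `Engine.lemma_5_3_rat_two_quadraticTwist_regular`;
(4) the `ℚ_ℓ ↔ K_λ` dictionary for the twin at a regular prime — `Engine.zsmul_mem_torsionLocalKer_iff_resTorsion_of_notMem_regular` applied to
    `E′ = W.quadraticTwist d_K` with the regular datum moved to `E′[2^M]` (`Engine.regularFrobDatum_of_smul_quadraticTwist_eq`), and
    «`Γ_{K_λ}` fixes `E[2^{M+1}]`» = `Engine.absGaloisRestrict_smul_geomTorsion_eq_regular`.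

* `two_pow_smul_selmer_twist_rat_eq_zero_signFree` — on the habitat (`W/ℚ` globally minimal, non-CM, odd Tamagawa product, an odd prime of
  multiplicative reduction, `ρ_{W,2^n}` onto; `K` imaginary quadratic, `d_K` odd `≠ −3`, Heegner, the two Theorem-B field exclusions; a frame
  `(Dt, β, ι)`, a conductor-`1` datum `d₁` with `2^{M₀+1} ∤ P(1)`; Q2 by name) with `w(W) = −1` and NO sign condition on `Δ(W)`:
  **for every `M` and every `s ∈ Sel_(2^M)(W^{(d_K)}/ℚ)`, `2^{M₀} • s = 0`** — SHARP.
* `two_pow_M0_smul_eq_zero_of_mem_sha_twist_rat_signFree` — hence `2^{M₀} · Ш(W^{(d_K)}/ℚ)[2^∞] = 0`.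

With gk2-p5 g31's `stub_b2qSignFree` (member `E`, `w = +1`) this completes Kolyvagin's Theorem B₂ at `2` over `ℚ` on the habitat for BOTH members of a
Heegner pair and BOTH signs of `Δ`, modulo Q2: `2^{M₀}` kills the `2^M`-Selmer group of the rank-zero member whichever curve carries the system.
For LINE 23 this is the `Δ > 0` input of DIV′ on the odd cut (the `Δ > 0` RANKQ⁻ / sandwich are the successor's).  In print: Kolyvagin 1989 Thm. B_l
(`l = 2`, `A = E^D`); nothing beyond print is claimed.

References: [Kolyvagin1989Izv] Thm. B_l, §3; [McCallumLMS1991] §3 Cor. 3.2, §4 Prop. 4.4, Lemma 4.6, §5 Lemma 5.3; [GrossLMS1991] §3 (3.1)–(3.3),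
§5 (5.1), Props. 5.4, 6.2; [SilvermanAEC2009] X.4.2, X.5 Cor. 5.4; [MilneADT2006] I Cor. 3.4, Rem. 3.7; [SerreGaloisCohomology1997] I §2.4.
-/

set_option autoImplicit false
-- the Theorems namespace of this sub repeats the summit name by design (D-0017 nested layout)
set_option linter.dupNamespace false

noncomputable section

open scoped Classical
open scoped AddSubgroup

namespace Summit.BirchSwinnertonDyer.BirchSwinnertonDyer.Theorems.GenusExact.TwinSwap.TwinAnnihilation

open WeierstrassCurve NumberField IsDedekindDomain Field Rat.HeightOneSpectrum Literature.NumberTheory.EllipticCurves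
  Literature.NumberTheory.GaloisRepresentations Literature.NumberTheory.EllipticCurves.ModularForms AddSubgroup
  Literature.NumberTheory.EllipticCurves.RingClassField
open Summit.BirchSwinnertonDyer.BirchSwinnertonDyer.Theses.GenusKolyvaginAtTwo (KolyvaginRelationAtTwo)
open Summit.BirchSwinnertonDyer.Rank1Residual
open Summit.BirchSwinnertonDyer.BirchSwinnertonDyer.Theorems.GenusExact
open Summit.BirchSwinnertonDyer.BirchSwinnertonDyer.Theorems.GenusExact.PlusDescent
open Summit.BirchSwinnertonDyer.BirchSwinnertonDyer.Theorems.GenusExact.TwinGrossPrimes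
open Summit.BirchSwinnertonDyer.BirchSwinnertonDyer.Theorems.GenusExact.VisiblePairAtTwo
  (liesOver_of_natCast_mem natCast_mem_primesEquiv_symm natCast_prime_mem_iff_eq hasGoodReductionAt_of_hasGoodReductionAtPrime
    not_mem_range intCast_notMem_of_not_dvd)
open Summit.BirchSwinnertonDyer.BirchSwinnertonDyer.Theorems.OffBigImageOddLocalAtTwo

/-- **(B2Q⁻±) Kolyvagin's Theorem B₂ at `l = 2` over `ℚ` FOR THE TWIN, SIGN-FREE, SHARP**: on the habitat with `w(W) = −1` and no sign condition
on `Δ(W)`, `2^{M₀} • s = 0` for every `s ∈ Sel_(2^M)(W^{(d_K)}/ℚ)`, every `M` (modulo Q2).  See the module docstring for the four replacements.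
(Adapted from this seat's `two_pow_smul_selmer_twist_rat_eq_zero_onHabitat` and gk2-p5 g31's `two_pow_smul_selmer_rat_eq_zero_of_regularPairSupply`.)
[cite: Kolyvagin1989Izv, Thm. B_l (l = 2, A = E^D), §3] [cite: McCallumLMS1991, §3 Cor. 3.2, §4 Prop. 4.4, §5 Lemma 5.3] [cite: GrossLMS1991, §5 (5.1), Props. 5.4, 6.2] -/
theorem two_pow_smul_selmer_twist_rat_eq_zero_signFree (hQ2 : KolyvaginRelationAtTwo)
    (W : WeierstrassCurve ℚ) [W.IsElliptic] [W.IsGloballyMinimal] [NeZero (W.conductorNorm ℤ)] (hcm : ¬ W.HasCM)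
    (hT : Odd W.tamagawaProduct) (v : HeightOneSpectrum (𝓞 ℚ)) (h2v : ((2 : ℕ) : 𝓞 ℚ) ∉ v.asIdeal)
    (hNv : ((W.conductorNorm ℤ : ℕ) : 𝓞 ℚ) ∈ v.asIdeal) (hmult : W.HasMultiplicativeReductionAt v)
    (K : Type) [Field K] [NumberField K] (hIQ : IsImaginaryQuadratic K) (hodd : Odd (NumberField.discr K))
    (h3 : NumberField.discr K ≠ -3) (hHe : SatisfiesHeegnerHypothesis (W.conductorNorm ℤ) K)
    (hsq1 : ¬ IsSquare ((NumberField.discr K : ℚ) * -|W.Δ|)) (hsq2 : ¬ IsSquare ((NumberField.discr K : ℚ) * (-(2 * |W.Δ|))))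
    (hρ : ∀ n : ℕ, 0 < n → W.HasSurjectiveModNGaloisRep ((2 : ℤ) ^ n))
    (Dt : ModularParametrizationData W (W.conductorNorm ℤ)) (β : ℤ) (ι : K →+* ℂ) (d₁ : KolyvaginHeegnerData Dt β ι 1) (M₀ : ℕ)
    (hndiv : ¬ ∃ Q : (W.baseChange (ringClassField K ι 1)).toAffine.Point, ((2 ^ (M₀ + 1) : ℕ) : ℤ) • Q = d₁.derivedPoint)
    (hw : W.rootNumber = -1)
    [(W.quadraticTwist ((NumberField.discr K : ℤ) : ℚ)).IsElliptic]
    (M : ℕ) (s₀ : galH1Torsion (W.quadraticTwist ((NumberField.discr K : ℤ) : ℚ)) ((2 ^ M : ℕ) : ℤ))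
    (hs₀ : s₀ ∈ selmerGroup (W.quadraticTwist ((NumberField.discr K : ℤ) : ℚ)) ((2 ^ M : ℕ) : ℤ)) :
    ((2 ^ M₀ : ℕ) : ℤ) • s₀ = 0 := by
  haveI : Fact (Nat.Prime 2) := ⟨Nat.prime_two⟩
  haveI : ∀ j : ℕ, NumberField (ringClassField K ι j) := JET.numberField_ringClassField K hIQ ι
  haveI hell : (W.baseChange K).IsElliptic := inferInstanceAs ((W.map (algebraMap ℚ K)).IsElliptic)
  -- ### the trivial range `M ≤ M₀`
  by_cases hMM₀ : M ≤ M₀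
  · obtain ⟨e, he⟩ := Nat.exists_eq_add_of_le hMM₀
    have h0 : ((2 ^ M : ℕ) : ℤ) • s₀ = 0 := zsmul_discreteH1_torsion _ s₀
    have hpow : ((2 ^ M₀ : ℕ) : ℤ) = ((2 ^ e : ℕ) : ℤ) * ((2 ^ M : ℕ) : ℤ) := by
      rw [he, pow_add]; push_cast; ring
    rw [hpow, mul_smul, h0, zsmul_zero]
  have hM₀M : M₀ + 1 ≤ M := by omega
  have hM : 1 ≤ M := le_trans (Nat.le_add_left 1 M₀) hM₀M
  have hM' : 1 ≤ M + 1 := by omega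
  -- ### numerics and currencies
  have hsurN : ∀ m : ℕ, W.HasSurjectiveModNGaloisRep ((2 ^ m : ℕ) : ℤ) :=
    MinimalTwinBSDTwo.forall_hasSurjectiveModNGaloisRep_two_pow_of_pos W hρ
  have hρN : ∀ m : ℕ, W.HasSurjectiveModNGaloisRep (2 ^ m : ℕ) := fun m ↦ by exact_mod_cast hsurN m
  have hsurj1 : W.HasSurjectiveModNGaloisRep ((2 : ℤ) ^ 1) := hρ 1 one_pos
  have hs2 : W.HasSurjectiveModNGaloisRep 2 := by simpa using hsurj1
  have h2 : Module.finrank ℚ K = 2 := hIQ.1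
  have hN : (W.conductorNorm ℤ) ≠ 0 := NeZero.ne _
  have hD4 : NumberField.discr K ≠ -4 := fun h ↦ by
    rw [h] at hodd; exact (Int.not_even_iff_odd.mpr hodd) ⟨-2, by norm_num⟩
  have hD : NumberField.discr K < -4 := X11b.KolyvaginAssembly.discr_lt_neg_four hIQ ⟨h3, hD4⟩
  have hdK0 : ((NumberField.discr K : ℤ) : ℚ) ≠ 0 := by exact_mod_cast NumberField.discr_ne_zero K
  -- the complex conjugation `τ = σ_θ`, `θ² = d_K` (the same `θ` presents the twist: `E′ = W^{(θ²)}`)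
  obtain ⟨θ, hθ, hd⟩ := Literature.NumberTheory.QuadraticFields.Quadratic.exists_not_mem_range_sq_eq_discr (K := K) h2
  set τ : K ≃ₐ[ℚ] K := sigmaQ K h2 hθ hd with hτdef
  have hτ : τ ≠ 1 := sigmaQ_ne_one K h2 hθ hd
  -- ### no `2`-power torsion in `E(K)`
  have htorsK : ∀ (m : ℕ) (P : (W.baseChange K).toAffine.Point), ((2 ^ m : ℕ) : ℤ) • P = 0 → P = 0 := fun m P hP ↦
    EigenClassesFinite.forall_zsmul_two_pow_baseChange_eq_zero_of_hasSurjectiveModNGaloisRep_two W K h2 hs2 m P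
      (by exact_mod_cast hP)
  -- ### (NPh) at levels `M` and `M + 1` from the multiplicative prime
  have hNPh : ∀ (L : ℕ), 1 ≤ L → ∀ z : galH1Torsion (W.baseChange K) ((2 ^ L : ℕ) : ℤ),
      (∀ ρ' ∈ torsionFixing (W.baseChange K) ((2 ^ L : ℕ) : ℤ), h1Eval (W.baseChange K) ((2 ^ L : ℕ) : ℤ) z ρ' = 0) →
      (∀ w : HeightOneSpectrum (𝓞 K), z ∈ selmerLocalKer (W.baseChange K) (w.adicCompletion K) ((2 ^ L : ℕ) : ℤ)) → z = 0 :=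
    fun L hL z hz hzS ↦ NonPhantomPow.nonPhantomAtTwo_of_hasMultiplicativeReductionAt (W := W) (K := K) hT hρ hIQ hodd hsq1 hsq2 hN hHe
      h2v hNv hmult L hL z hz (fun w _ ↦ hzS w)
  -- ### the Selmer class over `K`: `s = hPsiKT (res s₀)`, `τ`-ANTI-invariant (Gross §5 (5.1)), same order `2^a`
  set s : galH1Torsion (W.baseChange K) ((2 ^ M : ℕ) : ℤ) :=
    hPsiKT W K hθ hd ((2 ^ M : ℕ) : ℤ) (resTorsion (W.quadraticTwist ((NumberField.discr K : ℤ) : ℚ)) K ((2 ^ M : ℕ) : ℤ) s₀) with hsdef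
  have hsSel : s ∈ selmerGroup (W.baseChange K) ((2 ^ M : ℕ) : ℤ) :=
    (hPsiKT_resTorsion_mem_selmerGroup_and_conjAct_eq W K h2 hθ hd ((2 ^ M : ℕ) : ℤ) hs₀).1
  have hτs : conjAct W τ ((2 ^ M : ℕ) : ℤ) s = (-1 : ℤ) • s :=
    (hPsiKT_resTorsion_mem_selmerGroup_and_conjAct_eq W K h2 hθ hd ((2 ^ M : ℕ) : ℤ) hs₀).2
  have hinjres : Function.Injective (resTorsion (W.quadraticTwist ((NumberField.discr K : ℤ) : ℚ)) K ((2 ^ M : ℕ) : ℤ)) :=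
    EigenClassesFinite.resTorsion_twist_injective_of_noTorsion W K h2 hθ hd ((2 ^ M : ℕ) : ℤ) (htorsK M)
  have hinjψ : Function.Injective (fun x : galH1Torsion (W.quadraticTwist ((NumberField.discr K : ℤ) : ℚ)) ((2 ^ M : ℕ) : ℤ) ↦
      hPsiKT W K hθ hd ((2 ^ M : ℕ) : ℤ) (resTorsion (W.quadraticTwist ((NumberField.discr K : ℤ) : ℚ)) K ((2 ^ M : ℕ) : ℤ) x)) :=
    fun x₁ x₂ h ↦ hinjres ((hPsiKT W K hθ hd ((2 ^ M : ℕ) : ℤ)).injective h)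
  obtain ⟨a, haM, ha⟩ := exists_addOrderOf_galH1Torsion_eq_two_pow W K M s
  by_cases ha0 : a = 0
  · -- `s = 0`, hence `s₀ = 0`
    have hs0 : s = 0 := AddMonoid.addOrderOf_eq_one_iff.mp (by rw [ha, ha0, pow_zero])
    have : s₀ = 0 := hinjψ (by
      change s = hPsiKT W K hθ hd ((2 ^ M : ℕ) : ℤ) (resTorsion (W.quadraticTwist ((NumberField.discr K : ℤ) : ℚ)) K ((2 ^ M : ℕ) : ℤ) 0)
      rw [hs0, map_zero, map_zero])
    rw [this, zsmul_zero]
  have ha1 : 1 ≤ a := Nat.one_le_iff_ne_zero.mpr ha0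
  -- ### the Heegner class `y = c_M(1) = δ Ph`, order `2^κ`, `κ ≥ M − M₀`, sign `−w = +1`
  have hdiv : ∀ P : geomPoints (W.baseChange K), ∃ Q : geomPoints (W.baseChange K), ((2 ^ M : ℕ) : ℤ) • Q = P :=
    (W.baseChange K).zsmul_geomPoints_surjective_of_charZero (by positivity)
  set δ := kummerMapTorsion (W.baseChange K) ((2 ^ M : ℕ) : ℤ) hdiv with hδ
  have hker : δ.ker = (zsmulAddGroupHom (α := (W.baseChange K).toAffine.Point) ((2 ^ M : ℕ) : ℤ)).range :=
    kummerMapTorsion_ker (W.baseChange K) ((2 ^ M : ℕ) : ℤ) hdiv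
  obtain ⟨Ph, hPh, hPhmap⟩ := AdditiveKoly.exists_isHeegnerPoint_map_eq_derivedPoint_one (W := W) (K := K) (Dt := Dt) (β := β)
    (ι := ι) hIQ hHe d₁
  set y := d₁.kolyvaginClass Nat.prime_two M with hydef
  have hc1 : y = δ Ph := VisiblePairAtTwo.kolyvaginClass_one_two_eq_kummerMapTorsion W K hIQ hodd hHe hsurj1 M d₁ Ph hPhmap
  have hP₀ : ∀ Q : (W.baseChange K).toAffine.Point, ((2 ^ (M₀ + 1) : ℕ) : ℤ) • Q ≠ Ph :=
    forall_two_pow_smul_ne_bottom_of_not_dvd_derivedPoint d₁ Ph hPhmap le_rfl hndiv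
  obtain ⟨κ, hκM, hκ⟩ := exists_addOrderOf_galH1Torsion_eq_two_pow W K M y
  have hκge : M - M₀ ≤ κ := by
    by_contra hlt'
    have h0 : ((2 ^ κ : ℕ) : ℤ) • y = 0 := (two_pow_zsmul_eq_zero_iff_of_addOrderOf W K hκ κ).mpr le_rfl
    have hmem : ((2 ^ κ : ℕ) : ℤ) • Ph ∈ δ.ker := by rw [AddMonoidHom.mem_ker, map_zsmul, ← hc1, h0]
    rw [hker] at hmem
    obtain ⟨R, hR⟩ := hmem
    have hPhR : Ph = ((2 ^ (M - κ) : ℕ) : ℤ) • R := eq_two_pow_zsmul_of_two_pow_zsmul_eq (htorsK 1 · <| by simpa using ·) hκM hR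
    refine hP₀ (((2 ^ (M - κ - (M₀ + 1)) : ℕ) : ℤ) • R) ?_
    rw [hPhR, smul_smul]
    congr 1
    push_cast
    rw [← pow_add]
    congr 1
    omega
  have hκ1 : 1 ≤ κ := by omega
  have h1K : ∀ q ∈ (1 : ℕ).primeFactors, Zhang2014.IsKolyvaginPrime (W.conductorNorm ℤ) W K 2 q ∧ M ≤ Zhang2014.kolyvaginIndex W 2 q := by
    simp
  obtain ⟨-, hτy⟩ := KolyvaginClassSign.sign_conjAct_kolyvaginClass_two hIQ h3 hD4 hodd hHe hsurj1 τ hτ Dt β ι squarefree_one hM h1K d₁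
  rw [Nat.primeFactors_one, Finset.card_empty, pow_zero, mul_one, hw, neg_neg] at hτy
  -- `hτy : conjAct W τ _ y = (1 : ℤ) • y`
  -- ### ONE LEVEL UP: `ι_* s`, `ι_* y` at level `2^(M+1)`
  have hdvd : ((2 ^ M : ℕ) : ℤ) ∣ ((2 ^ (M + 1) : ℕ) : ℤ) := KolyvaginPairDataTwo.two_pow_dvd_two_pow_succ M
  set ιM := torsionH1OfDvd (W.baseChange K) hdvd with hιM
  have hιinj : Function.Injective ιM := KolyvaginPairDataTwo.torsionH1OfDvd_succ_injective W M hIQ hs2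
  have hsSel' : ιM s ∈ selmerGroup (W.baseChange K) ((2 ^ (M + 1) : ℕ) : ℤ) := torsionH1OfDvd_mem_selmerGroup (W.baseChange K) hdvd hsSel
  have hySel : y ∈ selmerGroup (W.baseChange K) ((2 ^ M : ℕ) : ℤ) := by
    rw [hc1]; exact WeierstrassCurve.kummerMapTorsion_mem_selmerGroup (W.baseChange K) _ hdiv Ph
  have hySel' : ιM y ∈ selmerGroup (W.baseChange K) ((2 ^ (M + 1) : ℕ) : ℤ) := torsionH1OfDvd_mem_selmerGroup (W.baseChange K) hdvd hySel
  have hords' : addOrderOf (ιM s) = 2 ^ a := by rw [addOrderOf_injective ιM hιinj, ha]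
  have hordy' : addOrderOf (ιM y) = 2 ^ κ := by rw [addOrderOf_injective ιM hιinj, hκ]
  have hτs' : conjAct W τ ((2 ^ (M + 1) : ℕ) : ℤ) (ιM s) = (-1 : ℤ) • ιM s := by
    rw [hιM, conjAct_torsionH1OfDvd W τ hdvd s, hτs, map_zsmul]
  have hτy' : conjAct W τ ((2 ^ (M + 1) : ℕ) : ℤ) (ιM y) = (1 : ℤ) • ιM y := by
    rw [hιM, conjAct_torsionH1OfDvd W τ hdvd y, hτy, map_zsmul]
  -- separation for the pair from (NPh_{M+1}): both classes are Selmer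
  have hres : ∀ a' b' : ℤ, (∀ ρ' ∈ torsionFixing (W.baseChange K) ((2 ^ (M + 1) : ℕ) : ℤ),
      h1Eval (W.baseChange K) ((2 ^ (M + 1) : ℕ) : ℤ) (a' • ιM s + b' • ιM y) ρ' = 0) → a' • ιM s + b' • ιM y = 0 := by
    intro a' b' hab
    have hmem : a' • ιM s + b' • ιM y ∈ selmerGroup (W.baseChange K) ((2 ^ (M + 1) : ℕ) : ℤ) :=
      add_mem (AddSubgroup.zsmul_mem _ hsSel' a') (AddSubgroup.zsmul_mem _ hySel' b')
    exact hNPh (M + 1) hM' _ hab (fun w ↦ (((W.baseChange K).mem_selmerGroup_iff _ _).mp hmem).1 w)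
  -- ### the REGULAR Kolyvagin prime from the regular signed pair-Čebotarev supply (gk2-p4 g23 / gk2-p5 g31, ANY sign of `Δ`), signs `(−1, +1)`
  obtain ⟨ℓ, hkolZ, hidx', hfrob, hloc'⟩ := regularPairSupply_of_heegner W K hIQ hodd hHe hρ M τ hτ (ιM s) (ιM y) a κ ha1 hκ1 hords' hordy'
    (-1) 1 (Or.inr rfl) (Or.inl rfl) hτs' hτy' hres
  obtain ⟨hℓp, hℓN, hℓdK, hℓ2, hℓprime, hidxpos⟩ := hkolZ
  haveI : Fact ℓ.Prime := ⟨hℓp⟩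
  have hkolZ : Zhang2014.IsKolyvaginPrime (W.conductorNorm ℤ) W K 2 ℓ := ⟨hℓp, hℓN, hℓdK, hℓ2, hℓprime, hidxpos⟩
  have hidxM : M ≤ Zhang2014.kolyvaginIndex W 2 ℓ := le_trans (Nat.le_succ M) hidx'
  obtain ⟨vP, 𝔓, hfr, c₀, hℓvP, h𝔓, hhfr, hc₀, hhsq, hhu, hhK⟩ := hfrob
  -- the place `λ = (ℓ)` of `K`
  set w : HeightOneSpectrum (𝓞 K) := ⟨Ideal.span {(ℓ : 𝓞 K)}, hℓprime, by
    rw [Ne, Ideal.span_singleton_eq_bot]; exact_mod_cast hℓp.ne_zero⟩ with hwdef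
  have hwℓ : (ℓ : 𝓞 K) ∈ w.asIdeal := Ideal.mem_span_singleton_self _
  -- the rational place `v_ℓ` and its local data
  set vℓ : HeightOneSpectrum (𝓞 ℚ) := primesEquiv.symm ⟨ℓ, hℓp⟩ with hvℓdef
  have hℓv : (ℓ : 𝓞 ℚ) ∈ vℓ.asIdeal := natCast_mem_primesEquiv_symm hℓp
  have hvPℓ : vP = vℓ := (natCast_prime_mem_iff_eq hℓp vP).mp hℓvP
  obtain ⟨h2vℓ, hqv⟩ := SelmerDescent.two_notMem_and_natCast_two_pow_notMem (rfl : 2 ^ M = 2 ^ M) hℓp hℓ2 hℓv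
  have hdKv : ((NumberField.discr K : ℤ) : 𝓞 ℚ) ∉ vℓ.asIdeal := intCast_notMem_of_not_dvd hℓp hℓv hℓdK
  haveI hLO : w.asIdeal.LiesOver vℓ.asIdeal := liesOver_of_natCast_mem hℓp hℓv hwℓ
  have hgood : W.HasGoodReductionAtPrime ℓ := hasGoodReductionAtPrime_of_not_dvd_conductorNorm W hℓN
  have hgoodv : W.HasGoodReductionAt vℓ := hasGoodReductionAt_of_hasGoodReductionAtPrime W hgood hℓv
  have hgoodK : (W.baseChange K).HasGoodReductionAt w := Engine.hasGoodReductionAt_baseChange_of_rat W hℓp hℓv hgoodv hwℓ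
  have hf : w.asIdeal.inertiaDeg (𝓞 ℚ) = 2 :=
    Summit.BirchSwinnertonDyer.Rank1Residual.X11b.Three.Koly.Method2.LocalFrob.inertiaDeg_eq_two_of_isPrime_span K h2 hℓp hℓprime w hwℓ
  -- the regular Frobenius datum in the three consumer shapes
  have hfrob' : ∃ (v' : HeightOneSpectrum (𝓞 ℚ)) (𝔓' : Ideal (absIntegers (𝓞 ℚ) ℚ)) (h' : absoluteGaloisGroup ℚ),
      (ℓ : 𝓞 ℚ) ∈ v'.asIdeal ∧ 𝔓' ∈ v'.primesAbove ∧ IsArithFrobAt (𝓞 ℚ) h' 𝔓' ∧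
      (∀ P : geomTorsion W ((2 ^ (M + 1) : ℕ) : ℤ), h' • P = hfr • P) ∧
      ∀ (e : K →ₐ[ℚ] AlgebraicClosure ℚ) (z : K), h' • e z = c₀ • e z :=
    ⟨vP, 𝔓, hfr, hℓvP, h𝔓, hhfr, fun _ ↦ rfl, hhK⟩
  have h𝔓ℓ : 𝔓 ∈ vℓ.primesAbove := hvPℓ ▸ h𝔓
  have hreg2 : ∃ (𝔓' : Ideal (absIntegers (𝓞 ℚ) ℚ)) (h' : absoluteGaloisGroup ℚ), 𝔓' ∈ vℓ.primesAbove ∧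
      IsArithFrobAt (𝓞 ℚ) h' 𝔓' ∧ (∀ P : geomTorsion W ((2 : ℕ) : ℤ), h' • h' • P = P) ∧
      ∃ u : geomTorsion W ((2 : ℕ) : ℤ), h' • u ≠ u :=
    ⟨𝔓, hfr, h𝔓ℓ, hhfr, smul_smul_eq_self_of_dvd W (by exact_mod_cast dvd_pow_self 2 (Nat.succ_ne_zero M)) hhsq, hhu⟩
  have hregM : ∃ (𝔓' : Ideal (absIntegers (𝓞 ℚ) ℚ)) (h' : absoluteGaloisGroup ℚ), 𝔓' ∈ vℓ.primesAbove ∧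
      IsArithFrobAt (𝓞 ℚ) h' 𝔓' ∧ (∀ X : geomTorsion W ((2 ^ M : ℕ) : ℤ), h' • h' • X = X) ∧
      ∃ u : geomTorsion W 2, h' • u ≠ u :=
    ⟨𝔓, hfr, h𝔓ℓ, hhfr, smul_smul_eq_self_of_dvd W hdvd hhsq, exists_smul_ne_two_of_natCast W hhu⟩
  -- ### the TWIN at the regular Kolyvagin prime: good reduction at `ℓ`, the regular datum moved to `E′[2^M]` (sibling `EngineRegularTwin`)
  have h1T : (1 : VariableChange ℚ) • W.quadraticTwist ((NumberField.discr K : ℤ) : ℚ) = (W.quadraticTwist ((NumberField.discr K : ℤ) : ℚ)) :=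
    one_smul _ _
  have hgoodT : (W.quadraticTwist ((NumberField.discr K : ℤ) : ℚ)).HasGoodReductionAtPrime ℓ :=
    hasGoodReductionAtPrime_of_smul_quadraticTwist_eq W h2 hodd (W.quadraticTwist ((NumberField.discr K : ℤ) : ℚ)) h1T hℓdK hgood
  have hgoodTv : (W.quadraticTwist ((NumberField.discr K : ℤ) : ℚ)).HasGoodReductionAt vℓ :=
    hasGoodReductionAt_of_hasGoodReductionAtPrime (W.quadraticTwist ((NumberField.discr K : ℤ) : ℚ)) hgoodT hℓv
  have hregMT : ∃ (𝔓' : Ideal (absIntegers (𝓞 ℚ) ℚ)) (h' : absoluteGaloisGroup ℚ), 𝔓' ∈ vℓ.primesAbove ∧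
      IsArithFrobAt (𝓞 ℚ) h' 𝔓' ∧ (∀ X : geomTorsion (W.quadraticTwist ((NumberField.discr K : ℤ) : ℚ)) ((2 ^ M : ℕ) : ℤ), h' • h' • X = X) ∧
      ∃ u : geomTorsion (W.quadraticTwist ((NumberField.discr K : ℤ) : ℚ)) 2, h' • u ≠ u :=
    Engine.regularFrobDatum_of_smul_quadraticTwist_eq W (W.quadraticTwist ((NumberField.discr K : ℤ) : ℚ)) hdK0 h1T hregM
  -- ### full local orders at `λ`, transferred back to level `2^M` (`Γ_{K_λ}` fixes `E[2^(M+1)]`)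
  obtain ⟨hαs', hαy'⟩ := hloc' w hwℓ
  have hmw : ((((2 ^ (M + 1) : ℕ) : ℕ) : ℤ) : 𝓞 K) ∉ w.asIdeal := fun hm ↦ by
    apply not_natCast_mem_of_prime_ne hℓp Nat.prime_two hℓ2 w hwℓ
    rw [Int.cast_natCast, Nat.cast_pow] at hm
    exact w.isPrime.mem_of_pow_mem _ hm
  haveI : NeZero (2 ^ (M + 1)) := ⟨pow_ne_zero _ two_ne_zero⟩
  have htriv : ∀ (g : absoluteGaloisGroup (w.adicCompletion K)) (Q : geomTorsion (W.baseChange K) ((2 ^ (M + 1) : ℕ) : ℤ)),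
      resGal (K := K) (w.adicCompletion K) g • Q = Q := fun g Q ↦
    Engine.absGaloisRestrict_smul_geomTorsion_eq_regular W hIQ hc₀ hhsq hℓp hℓprime hfrob' hwℓ hgoodK hmw g Q
  have htrans : ∀ x : galH1Torsion (W.baseChange K) ((2 ^ M : ℕ) : ℤ), x ∈ (W.baseChange K).torsionLocalKer (w.adicCompletion K) ((2 ^ M : ℕ) : ℤ) ↔
      ιM x ∈ (W.baseChange K).torsionLocalKer (w.adicCompletion K) ((2 ^ (M + 1) : ℕ) : ℤ) := fun x ↦
    mem_torsionLocalKer_iff_torsionH1OfDvd_mem (W.baseChange K) (w.adicCompletion K) (pow_dvd_pow 2 (Nat.le_succ M))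
      (pow_ne_zero _ two_ne_zero) (pow_ne_zero _ two_ne_zero) htriv x
  have hαs : ∀ j : ℕ, ((2 ^ j : ℕ) : ℤ) • s ∈ (W.baseChange K).torsionLocalKer (w.adicCompletion K) ((2 ^ M : ℕ) : ℤ) ↔ a ≤ j := fun j ↦ by
    rw [htrans, map_zsmul]; exact hαs' j
  have hαy : ∀ j : ℕ, ((2 ^ j : ℕ) : ℤ) • y ∈ (W.baseChange K).torsionLocalKer (w.adicCompletion K) ((2 ^ M : ℕ) : ℤ) ↔ κ ≤ j := fun j ↦ by
    rw [htrans, map_zsmul]; exact hαy' j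
  -- ### the datum at conductor `ℓ` compatible with `d₁`, its class `x = c_M(ℓ)` (sign `−1`) and Q2 at `λ`
  obtain ⟨dℓ, hdℓ⟩ := JET.exists_compatible_data_of_grossCM
    (phi_heegnerPointOfConductor_mem_range_map_ringClassField_holds (W.conductorNorm ℤ) W K) hIQ hD hHe 2 Dt β ι
    squarefree_one (by simp) d₁
  have hℓ1 : ℓ ∉ (1 : ℕ).primeFactors := by simp
  obtain ⟨hσ', hS', hS'', hemb'⟩ := hdℓ ℓ hkolZ hℓ1
  set d' := dℓ ℓ hkolZ hℓ1 with hd'_def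
  set x := d'.kolyvaginClass Nat.prime_two M with hx_def
  have hc' : Squarefree (1 * ℓ) := by rw [one_mul]; exact hℓp.squarefree
  have hℓn : ¬ ℓ ∣ 1 := fun h ↦ hℓp.one_lt.ne' (Nat.dvd_one.mp h)
  have hkM : ∀ q ∈ (1 * ℓ).primeFactors, Zhang2014.IsKolyvaginPrime (W.conductorNorm ℤ) W K 2 q ∧ M ≤ Zhang2014.kolyvaginIndex W 2 q := by
    intro q hq
    rw [one_mul, hℓp.primeFactors, Finset.mem_singleton] at hq
    subst hq
    exact ⟨hkolZ, hidxM⟩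
  have hkM1 : ∀ q ∈ (1 * ℓ).primeFactors, Zhang2014.IsKolyvaginPrime (W.conductorNorm ℤ) W K 2 q ∧
      M + 1 ≤ Zhang2014.kolyvaginIndex W 2 q := by
    intro q hq
    rw [one_mul, hℓp.primeFactors, Finset.mem_singleton] at hq
    subst hq
    exact ⟨hkolZ, hidx'⟩
  have hcard : (1 * ℓ).primeFactors.card = 1 := by rw [one_mul, hℓp.primeFactors, Finset.card_singleton]
  -- signs: `c_M(ℓ)`, `c_{M+1}(ℓ)` are `τ`-ANTI-invariant (`−w·(−1) = −1` for `w = −1`)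
  obtain ⟨-, hx⟩ := KolyvaginClassSign.sign_conjAct_kolyvaginClass_two hIQ h3 hD4 hodd hHe hsurj1 τ hτ Dt β ι hc' hM hkM d'
  obtain ⟨-, hx1⟩ := KolyvaginClassSign.sign_conjAct_kolyvaginClass_two hIQ h3 hD4 hodd hHe hsurj1 τ hτ Dt β ι hc' hM' hkM1 d'
  rw [hcard, pow_one, hw, neg_neg] at hx hx1
  have hxneg : conjAct W τ ((2 ^ M : ℕ) : ℤ) x = -x := by
    rw [hx_def, hx, show ((1 : ℤ) * -1) = -1 by norm_num, neg_one_zsmul]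
  have hx1neg : conjAct W τ ((2 ^ (M + 1) : ℕ) : ℤ) (d'.kolyvaginClass Nat.prime_two (M + 1)) =
      -d'.kolyvaginClass Nat.prime_two (M + 1) := by
    rw [hx1, show ((1 : ℤ) * -1) = -1 by norm_num, neg_one_zsmul]
  -- Q2 at the own prime: Selmer threshold of `x` at `λ` = zero threshold `κ` of `y`
  have hQ := hQ2 W hcm K hIQ h3 hD4 hHe hρN Dt β ι M hM 1 ℓ hc' hℓp hℓn hkM d₁ d' hσ' hS' hS'' hemb' w hwℓ
  have hβ : ∀ j : ℕ, ((2 ^ j : ℕ) : ℤ) • x ∈ selmerLocalKer (W.baseChange K) (w.adicCompletion K) ((2 ^ M : ℕ) : ℤ) ↔ κ ≤ j :=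
    fun j ↦ (hQ j).1.trans (((hQ j).2).trans (hαy j))
  -- ### the TWIN ℚ-descent `u` of `x` (anti-invariant ⟹ descends to `E′`; TQ-DEEP twin form, margin one): Selmer off `v_ℓ` and at `∞`
  obtain ⟨u, hu, -⟩ := EigenClassesFinite.existsUnique_hPsiKT_resTorsion_eq_of_conjAct_eq_neg W K h2 hθ hd ((2 ^ M : ℕ) : ℤ) (htorsK M) hxneg
  have hufin : ∀ v' : HeightOneSpectrum (𝓞 ℚ), v' ≠ vℓ → u ∈ selmerLocalKer (W.quadraticTwist ((NumberField.discr K : ℤ) : ℚ)) (v'.adicCompletion ℚ) ((2 ^ M : ℕ) : ℤ) := by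
    intro v' hv'
    have hv'' : ∀ w' : HeightOneSpectrum (𝓞 K), w'.asIdeal.LiesOver v'.asIdeal → ((1 * ℓ : ℕ) : 𝓞 K) ∉ w'.asIdeal := by
      intro w' hw' hmem
      rw [one_mul] at hmem
      have hvmem : (ℓ : 𝓞 ℚ) ∈ v'.asIdeal := by
        have h : algebraMap (𝓞 ℚ) (𝓞 K) (ℓ : 𝓞 ℚ) ∈ w'.asIdeal := by rwa [map_natCast]
        rw [← Ideal.mem_comap, ← Ideal.under_def, ← Ideal.LiesOver.over (P := w'.asIdeal) (p := v'.asIdeal)] at h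
        exact h
      exact hv' ((natCast_prime_mem_iff_eq hℓp v').mp hvmem)
    obtain ⟨u', hu', hsel⟩ := SelmerDescent.exists_twin_descent_kolyvaginClass_two_mem_selmerLocalKer_of_margin W hsurN hT K hIQ h2 hθ
      hd h3 hD4 hHe Dt β ι M hc' hkM1 d' (htorsK (M + 1)) hx1neg hxneg v' hv''
    have huu : u' = u := hinjψ (hu'.trans hu.symm)
    rw [← huu]
    exact hsel
  have huinf : ∀ w' : InfinitePlace ℚ, u ∈ selmerLocalKer (W.quadraticTwist ((NumberField.discr K : ℤ) : ℚ)) w'.Completion ((2 ^ M : ℕ) : ℤ) := fun w' ↦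
    SelmerDescent.mem_selmerLocalKer_infinitePlace_twin_of_hPsiKT_resTorsion_eq_kolyvaginClass_two_of_margin W hsurN K hIQ h2 hθ hd h3 hD4 hHe
      Dt β ι M hc' hkM1 d' (htorsK (M + 1)) hx1neg hu w'
  -- the Selmer threshold of `u` at `v_ℓ` is `κ`: `2^(κ−1) • u` is NOT Selmer there (through `res` and `hPsiKT`)
  have hudv : ((2 : ℤ) ^ (κ - 1)) • u ∉ selmerLocalKer (W.quadraticTwist ((NumberField.discr K : ℤ) : ℚ)) (vℓ.adicCompletion ℚ) ((2 ^ M : ℕ) : ℤ) := by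
    intro hmem
    have h' : ((2 : ℤ) ^ (κ - 1)) • resTorsion (W.quadraticTwist ((NumberField.discr K : ℤ) : ℚ)) K ((2 ^ M : ℕ) : ℤ) u ∈ selmerLocalKer ((W.quadraticTwist ((NumberField.discr K : ℤ) : ℚ)).baseChange K) (w.adicCompletion K) ((2 ^ M : ℕ) : ℤ) :=
      (SelmerDescent.zsmul_mem_selmerLocalKer_iff_resTorsion (W.quadraticTwist ((NumberField.discr K : ℤ) : ℚ)) h2 (not_mem_range hθ) hd ((2 ^ M : ℕ) : ℤ) vℓ w hgoodTv hqv h2vℓ hdKv u _).mp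
        hmem
    have h'' : ((2 : ℤ) ^ (κ - 1)) • x ∈ selmerLocalKer (W.baseChange K) (w.adicCompletion K) ((2 ^ M : ℕ) : ℤ) := by
      rw [← hu]
      exact (EigenClassesFinite.zsmul_mem_selmerLocalKer_iff_hPsiKT_mem W K hθ hd ((2 ^ M : ℕ) : ℤ) (w.adicCompletion K) _ _).mp h'
    have h''' : ((2 ^ (κ - 1) : ℕ) : ℤ) • x ∈ selmerLocalKer (W.baseChange K) (w.adicCompletion K) ((2 ^ M : ℕ) : ℤ) := by exact_mod_cast h''
    have := (hβ (κ - 1)).mp h'''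
    omega
  -- ### McCallum 5.3 + 2.2 over `ℚ_ℓ` FOR THE TWIN AT A REGULAR PRIME (no lost bit): `2^(M − κ) • s₀` vanishes at `v_ℓ`
  have hdual := Engine.lemma_5_3_rat_two_quadraticTwist_regular W h2 hodd hM (q := 2 ^ M) rfl hℓ2 hℓdK hgood hℓv hreg2 hidxM hs₀
    hufin huinf hudv
  have hexp : M - 1 - (κ - 1) = M - κ := by omega
  rw [hexp] at hdual
  -- transfer to `K_λ` (REGULAR dictionary for the twin) and through `hPsiKT`
  have hdualK : ((2 : ℤ) ^ (M - κ)) • resTorsion (W.quadraticTwist ((NumberField.discr K : ℤ) : ℚ)) K ((2 ^ M : ℕ) : ℤ) s₀ ∈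
      ((W.quadraticTwist ((NumberField.discr K : ℤ) : ℚ)).baseChange K).torsionLocalKer (w.adicCompletion K) ((2 ^ M : ℕ) : ℤ) :=
    (Engine.zsmul_mem_torsionLocalKer_iff_resTorsion_of_notMem_regular (W.quadraticTwist ((NumberField.discr K : ℤ) : ℚ)) hM (q := 2 ^ M) rfl
      hℓp hℓ2 hℓv hgoodTv h2 (not_mem_range hθ) hd hdKv hregMT w hf s₀ ((2 : ℤ) ^ (M - κ))).mp hdual
  have hdualW : ((2 : ℤ) ^ (M - κ)) • s ∈ (W.baseChange K).torsionLocalKer (w.adicCompletion K) ((2 ^ M : ℕ) : ℤ) :=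
    (EigenClassesFinite.zsmul_mem_torsionLocalKer_iff_hPsiKT_mem W K hθ hd ((2 ^ M : ℕ) : ℤ) (w.adicCompletion K) _ _).mp hdualK
  have hdualW' : ((2 ^ (M - κ) : ℕ) : ℤ) • s ∈ (W.baseChange K).torsionLocalKer (w.adicCompletion K) ((2 ^ M : ℕ) : ℤ) := by
    exact_mod_cast hdualW
  -- ### conclusion: `a ≤ M − κ ≤ M₀`
  have haMκ : a ≤ M - κ := (hαs (M - κ)).mp hdualW'
  have haM₀ : a ≤ M₀ := by omega
  have hs0 : ((2 ^ M₀ : ℕ) : ℤ) • s = 0 := (two_pow_zsmul_eq_zero_iff_of_addOrderOf W K ha M₀).mpr haM₀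
  apply hinjψ
  change hPsiKT W K hθ hd ((2 ^ M : ℕ) : ℤ) (resTorsion (W.quadraticTwist ((NumberField.discr K : ℤ) : ℚ)) K ((2 ^ M : ℕ) : ℤ) (((2 ^ M₀ : ℕ) : ℤ) • s₀)) =
    hPsiKT W K hθ hd ((2 ^ M : ℕ) : ℤ) (resTorsion (W.quadraticTwist ((NumberField.discr K : ℤ) : ℚ)) K ((2 ^ M : ℕ) : ℤ) 0)
  rw [map_zsmul, map_zsmul, map_zero, map_zero]
  exact hs0

/-- **Corollary: `2^{M₀} · Ш(W^{(d_K)}/ℚ)[2^∞] = 0`, SIGN-FREE, on the habitat with `w(W) = −1`** — every class of `Ш(E′/ℚ)`,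
`E′ = W.quadraticTwist d_K`, killed by a power of `2` is killed by `2^{M₀}` (`Sel_(2^k)(E′/ℚ) ↠ Ш(E′/ℚ)[2^k]`, Silverman X.4.2(a), and the sharp
exponent `two_pow_smul_selmer_twist_rat_eq_zero_signFree`).  Kolyvagin 1989 Thm. B_l at `l = 2`, case `A = E^D`, on the habitat for EITHER sign
of `Δ(W)`, modulo Q2. [cite: Kolyvagin1989Izv, Thm. B_l (l = 2, A = E^D)] [cite: McCallumLMS1991, §1 Theorem] [cite: SilvermanAEC2009, Thm. X.4.2(a)] -/
theorem two_pow_M0_smul_eq_zero_of_mem_sha_twist_rat_signFree (hQ2 : KolyvaginRelationAtTwo)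
    (W : WeierstrassCurve ℚ) [W.IsElliptic] [W.IsGloballyMinimal] [NeZero (W.conductorNorm ℤ)] (hcm : ¬ W.HasCM)
    (hT : Odd W.tamagawaProduct) (v : HeightOneSpectrum (𝓞 ℚ)) (h2v : ((2 : ℕ) : 𝓞 ℚ) ∉ v.asIdeal)
    (hNv : ((W.conductorNorm ℤ : ℕ) : 𝓞 ℚ) ∈ v.asIdeal) (hmult : W.HasMultiplicativeReductionAt v)
    (K : Type) [Field K] [NumberField K] (hIQ : IsImaginaryQuadratic K) (hodd : Odd (NumberField.discr K))
    (h3 : NumberField.discr K ≠ -3) (hHe : SatisfiesHeegnerHypothesis (W.conductorNorm ℤ) K)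
    (hsq1 : ¬ IsSquare ((NumberField.discr K : ℚ) * -|W.Δ|)) (hsq2 : ¬ IsSquare ((NumberField.discr K : ℚ) * (-(2 * |W.Δ|))))
    (hρ : ∀ n : ℕ, 0 < n → W.HasSurjectiveModNGaloisRep ((2 : ℤ) ^ n))
    (Dt : ModularParametrizationData W (W.conductorNorm ℤ)) (β : ℤ) (ι : K →+* ℂ) (d₁ : KolyvaginHeegnerData Dt β ι 1) (M₀ : ℕ)
    (hndiv : ¬ ∃ Q : (W.baseChange (ringClassField K ι 1)).toAffine.Point, ((2 ^ (M₀ + 1) : ℕ) : ℤ) • Q = d₁.derivedPoint)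
    (hw : W.rootNumber = -1)
    [(W.quadraticTwist ((NumberField.discr K : ℤ) : ℚ)).IsElliptic]
    (k : ℕ) (a : (W.quadraticTwist ((NumberField.discr K : ℤ) : ℚ)).galH1)
    (ha : a ∈ (W.quadraticTwist ((NumberField.discr K : ℤ) : ℚ)).sha) (hka : ((2 ^ k : ℕ) : ℤ) • a = 0) :
    ((2 ^ M₀ : ℕ) : ℤ) • a = 0 := by
  rcases Nat.eq_zero_or_pos k with rfl | hkpos
  · rw [pow_zero, Nat.cast_one, one_zsmul] at hka
    rw [hka, zsmul_zero]
  · have hn : ((2 ^ k : ℕ) : ℤ) ≠ 0 := by positivity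
    have hmem : a ∈ (W.quadraticTwist ((NumberField.discr K : ℤ) : ℚ)).sha ⊓ torsionBy (W.quadraticTwist ((NumberField.discr K : ℤ) : ℚ)).galH1 ((2 ^ k : ℕ) : ℤ) :=
      AddSubgroup.mem_inf.mpr ⟨ha, by change ((2 ^ k : ℕ) : ℤ) • a = 0; exact hka⟩
    rw [← WeierstrassCurve.map_torsionH1ToH1_selmerGroup_holds (W.quadraticTwist ((NumberField.discr K : ℤ) : ℚ)) hn] at hmem
    obtain ⟨x, hx, rfl⟩ := AddSubgroup.mem_map.mp hmem
    rw [← map_zsmul, two_pow_smul_selmer_twist_rat_eq_zero_signFree hQ2 W hcm hT v h2v hNv hmult K hIQ hodd h3 hHe hsq1 hsq2 hρ Dt β ι d₁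
      M₀ hndiv hw k x hx, map_zero]

end Summit.BirchSwinnertonDyer.BirchSwinnertonDyer.Theorems.GenusExact.TwinSwap.TwinAnnihilation

end
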